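import Mathlib
import HarnessLib
import Literature.Geometry.DiscreteGeometry.BondGraph

/-!
# Reach of bond walks in the scale-free bond graph (crux `SoftLayerPropagation`, line `Sketch`)

Route `PricedLinkCensus`, crux `SoftLayerPropagation` (stmt-AtomisticToContinuum-14233), line
`Sketch`, helper file for the stub `stub_develop` (development of the exact shadow crystal on the
graph `5`-ball): registered sub-goal `develop_reach`.

Along a bond of `bondGraph η y` the own scale `nn` changes by a factor at most `1 + η`
(`nearestDist_le_mul_of_adj`) and the bond is no longer than `(1 + η) nn`
(`dist_le_of_adj`).  Hence a bond walk of length `m` from `i` stays within real distance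
`(Σ_{t<m} (1+η)^{t+1}) · nn_i` of `y i`, and the scales at its ends agree up to `(1+η)^m`
(`develop_reach`).  At `η ≤ 1/100` a walk of length `≤ 7` stays within `8 nn_i`
(`Σ_{t=1}^{7} 1.01^t = 7.2135… < 8`), so the graph `7`-ball about `i` lies in the charted real
`8 nn_i`-ball of the crux, with positive comparable scales (`develop_reach_seven`).
All `[folklore]`.
-/

noncomputable section

namespace Summit.AtomisticToContinuum.Crystallization.Theorems

open Literature.Geometry.DiscreteGeometry

/-- **Registered sub-goal `develop_reach`** of the crux item (REACH OF BOND WALKS).  For `η ≥ 0`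
and a walk `w` of the bond graph from `i` to `j`:
`dist (y i) (y j) ≤ (Σ_{t < |w|} (1+η)^{t+1}) · nn_i`, `nn_j ≤ (1+η)^{|w|} nn_i` and
`nn_i ≤ (1+η)^{|w|} nn_j`. [folklore] -/
theorem develop_reach :  ∀ (η : ℝ), 0 ≤ η → ∀ (N : ℕ) (y : Fin N → EuclideanSpace ℝ (Fin 3)) (i j
    : Fin N) (w : (Literature.Geometry.DiscreteGeometry.bondGraph η y).Walk i j), dist (y i) (y j)
    ≤ (∑ t ∈ Finset.range w.length, (1 + η) ^ (t + 1)) *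
    Literature.Geometry.DiscreteGeometry.nearestDist y i ∧
    Literature.Geometry.DiscreteGeometry.nearestDist y j ≤ (1 + η) ^ w.length *
    Literature.Geometry.DiscreteGeometry.nearestDist y i ∧
    Literature.Geometry.DiscreteGeometry.nearestDist y i ≤ (1 + η) ^ w.length *
    Literature.Geometry.DiscreteGeometry.nearestDist y j := by
  intro η hη N y i j w
  have h1 : (0 : ℝ) ≤ 1 + η := by linarith
  induction w with
  | nil =>
    simp
  | @cons a b c hab w ih =>
    obtain ⟨ih1, ih2, ih3⟩ := ih
    have hνa := nearestDist_nonneg y a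
    have hνb := nearestDist_nonneg y b
    have hνc := nearestDist_nonneg y c
    have hd : dist (y a) (y b) ≤ (1 + η) * nearestDist y a := dist_le_of_adj h1 hab
    have hs1 : nearestDist y b ≤ (1 + η) * nearestDist y a := nearestDist_le_mul_of_adj h1 hab.symm
    have hs2 : nearestDist y a ≤ (1 + η) * nearestDist y b := nearestDist_le_mul_of_adj h1 hab
    have hS : (0 : ℝ) ≤ ∑ t ∈ Finset.range w.length, (1 + η) ^ (t + 1) :=
      Finset.sum_nonneg fun t _ => pow_nonneg h1 _
    have hpow : (0 : ℝ) ≤ (1 + η) ^ w.length := pow_nonneg h1 _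
    rw [SimpleGraph.Walk.length_cons]
    refine ⟨?_, ?_, ?_⟩
    · rw [Finset.sum_range_succ', zero_add, pow_one]
      have e : ∑ t ∈ Finset.range w.length, (1 + η) ^ (t + 1 + 1) =
          (1 + η) * ∑ t ∈ Finset.range w.length, (1 + η) ^ (t + 1) := by
        rw [Finset.mul_sum]
        refine Finset.sum_congr rfl fun t _ => ?_
        ring
      rw [e]
      calc dist (y a) (y c) ≤ dist (y a) (y b) + dist (y b) (y c) := dist_triangle _ _ _
        _ ≤ (1 + η) * nearestDist y a +
            (∑ t ∈ Finset.range w.length, (1 + η) ^ (t + 1)) * nearestDist y b := add_le_add hd ih1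
        _ ≤ (1 + η) * nearestDist y a +
            (∑ t ∈ Finset.range w.length, (1 + η) ^ (t + 1)) * ((1 + η) * nearestDist y a) := by
            gcongr
        _ = ((1 + η) * ∑ t ∈ Finset.range w.length, (1 + η) ^ (t + 1) + 1 * (1 + η)) *
            nearestDist y a := by ring
        _ = _ := by rw [one_mul]
    · calc nearestDist y c ≤ (1 + η) ^ w.length * nearestDist y b := ih2
        _ ≤ (1 + η) ^ w.length * ((1 + η) * nearestDist y a) := by gcongr
        _ = (1 + η) ^ (w.length + 1) * nearestDist y a := by ring
    · calc nearestDist y a ≤ (1 + η) * nearestDist y b := hs2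
        _ ≤ (1 + η) * ((1 + η) ^ w.length * nearestDist y c) := by gcongr
        _ = (1 + η) ^ (w.length + 1) * nearestDist y c := by ring

/-- **Reach at `η ≤ 1/100`, length `≤ 7`.**  A bond walk of length at most `7` from `i` ends
within `8 nn_i` of `y i` (`Σ_{t=1}^{7} 1.01^t < 7.22 < 8`), with `nn_j ≤ 1.01^7 nn_i`,
`nn_i ≤ 1.01^7 nn_j`; in particular `nn_j > 0` as soon as `nn_i > 0`. [folklore] -/
theorem develop_reach_seven {η : ℝ} (hη : 0 ≤ η) (hη' : η ≤ 1 / 100) {N : ℕ}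
    {y : Fin N → EuclideanSpace ℝ (Fin 3)} {i j : Fin N} (w : (bondGraph η y).Walk i j)
    (hw : w.length ≤ 7) :
    dist (y i) (y j) ≤ 8 * nearestDist y i ∧
      nearestDist y j ≤ (101 / 100) ^ 7 * nearestDist y i ∧
      nearestDist y i ≤ (101 / 100) ^ 7 * nearestDist y j ∧
      (0 < nearestDist y i → 0 < nearestDist y j) := by
  obtain ⟨h1, h2, h3⟩ := develop_reach η hη N y i j w
  have hνi := nearestDist_nonneg y i
  have hνj := nearestDist_nonneg y j
  have hb : (1 : ℝ) ≤ 1 + η := by linarith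
  have hb' : 1 + η ≤ 101 / 100 := by linarith
  have hpow7 : (1 + η) ^ w.length ≤ (101 / 100 : ℝ) ^ 7 :=
    (pow_le_pow_right₀ hb hw).trans (pow_le_pow_left₀ (by linarith) hb' 7)
  have hsum : ∑ t ∈ Finset.range w.length, (1 + η) ^ (t + 1) ≤ 8 := by
    calc ∑ t ∈ Finset.range w.length, (1 + η) ^ (t + 1)
        ≤ ∑ t ∈ Finset.range 7, (1 + η) ^ (t + 1) := by
          apply Finset.sum_le_sum_of_subset_of_nonneg (Finset.range_mono hw)
          intro t _ _
          positivity
      _ ≤ ∑ t ∈ Finset.range 7, (101 / 100 : ℝ) ^ (t + 1) := by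
          refine Finset.sum_le_sum fun t _ => ?_
          exact pow_le_pow_left₀ (by linarith) hb' _
      _ ≤ 8 := by
          simp only [Finset.sum_range_succ, Finset.sum_range_zero]
          norm_num
  refine ⟨h1.trans (by nlinarith), h2.trans (by nlinarith), h3.trans (by nlinarith), fun hpos => ?_⟩
  have h7 : (0 : ℝ) < (1 + η) ^ w.length := by positivity
  by_contra hle
  have hz : nearestDist y j = 0 := le_antisymm (not_lt.1 hle) hνj
  rw [hz, mul_zero] at h3
  exact absurd (le_antisymm h3 hνi) hpos.ne'

end Summit.AtomisticToContinuum.Crystallization.Theorems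

end
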